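import Summits.QuantumFields.BalabanUV.T4Continuum.Support.NE7MinimiserHoelderHalf
import Summits.QuantumFields.BalabanUV.T4Continuum.Support.NE7GaugeGroupCompact
import Literature.Analysis.Complex.RungeUnits
import HarnessLib

/-!
# NE7MinimiserLipschitzPrep — LETTERS FOR THE LIPSCHITZ DEPENDENCE OF `U_k(V)` ON `V`: block-constant fine gauges over a coarse site field (corner values, periodicity), composition
# of gauge actions, the three bondwise estimates of the «optimal gauge» loop (regauging by a near-identity gauge, chart parameters, `U♯e^{X′}`), and THE OPTIMAL STABILISER COPY:
# over the compact group of unitary periodic fine gauges whose corner values fix the datum `V₀`, the bondwise distance of `U^{u}` to `U♯` (summed over the period box) attains its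
# minimum (`NE7GaugeGroupCompact.isCompact_unitaryPeriodicSite` + closedness + continuity)

Cell `pub-balaban`, rung (B)+1 sub-cell t4, lineage `b2b-balaban-t4-ne7-p1` (CRUX PROVER NE7 #1 = OWNER of BINDER row NE7), generation 114.  Memo
`t4/b2b-balaban-t4-ne7-p1-g114/ROAD-G114.md` §4.
WHAT ([folklore]; 0 def, 0 sorry).  `gaugeAct_mul_fun`, `isPeriodicSite_corner`, `blockConst_corner`, `blockConst_periodic`, `norm_relVal_eq`, `norm_regauge_sub_le`, `norm_gaugeAct_sub_gaugeAct`,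
`norm_chart_sub_chart_le`, `norm_vary_sub_le`, `relVal_term_le_sum`, **`exists_optimal_stab_copy`**.
HONEST FRAMING (page 1): bookkeeping and point-set topology over landed kernel theorems; nothing of Bałaban's asserted; NOT NE7, NOT NE3; spine 0∕9; finite T⁴ rung (B)+1 — NOT infinite
volume, NOT mass gap, NOT BetaPertH, NOT Clay (continuum YM on T⁴ ⇐ BetaPertH ∧ nine spine estimates).
-/

set_option autoImplicit false

open scoped BigOperators Matrix Matrix.Norms.L2Operator Topology
open NormedSpace Finset Set Filter

namespace Summit.QuantumFields.BalabanUV.T4Continuum.NE7MinimiserLipschitzPrep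

open Literature.MathematicalPhysics.QuantumFieldTheory.Balaban1983to89
open B7Prop1Explicit B7Prop2Explicit MatrixLog
open T4AveragingDeficitWall (IsUnitaryCfg IsSkewDir vary)
open T4AveragingDeficitWallBoundary (IsPeriodicCfg)
open AveragingDeficitTorusChart (TDir chart chartDir redN)
open AveragingDeficitTwoLevelPrep (skewSub)
open NE3EnergyShapes (IsUnitarySite IsPeriodicSite)
open NE7DatumCoordinateStabiliser (norm_conj_unitary inv_mem_unitary)
open NE7GaugeGroupCompact (isCompact_unitaryPeriodicSite)

noncomputable section

variable {d : ℕ} {n : Type*} [Fintype n] [DecidableEq n]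

/-! ## §1 Gauge bookkeeping: composition, corners, block-constant gauges -/

/-- Composition of gauge actions: `(a·b)·V = a·(b·V)`. [folklore] -/
theorem gaugeAct_mul_fun (a b : Site d → (Matrix n n ℂ)ˣ) (V : Site d → Fin d → (Matrix n n ℂ)ˣ) :
    gaugeAct (fun x => a x * b x) V = gaugeAct a (gaugeAct b V) := by
  funext x μ
  simp only [gaugeAct, mul_inv_rev]
  group

/-- The corner field `z ↦ u(P•z)` of an `(N·P)`-periodic site field is `N`-periodic. [folklore] -/
theorem isPeriodicSite_corner {u : Site d → (Matrix n n ℂ)ˣ} {N P : ℕ} (hu : IsPeriodicSite u ((N * P : ℕ) : ℤ)) :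
    IsPeriodicSite (fun z : Site d => u ((P : ℤ) • z)) (N : ℤ) := by
  intro z i
  have e1 : (P : ℤ) • (z + (N : ℤ) • e i) = (P : ℤ) • z + ((N * P : ℕ) : ℤ) • e i := by
    rw [smul_add, smul_smul]; push_cast; rw [mul_comm]
  show u ((P : ℤ) • (z + (N : ℤ) • e i)) = u ((P : ℤ) • z)
  rw [e1, hu]

/-- The block-constant extension `x ↦ g(⌊x∕P⌋)` has corner values `g`: at `P•z` it is `g z` (`P ≥ 1`). [folklore] -/
theorem blockConst_corner {α : Type*} (g : Site d → α) {P : ℕ} (hP : 1 ≤ P) (z : Site d) :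
    (fun x : Site d => g (fun i => x i / (P : ℤ))) ((P : ℤ) • z) = g z := by
  have hP0 : (P : ℤ) ≠ 0 := by exact_mod_cast (by omega : P ≠ 0)
  show g (fun i => ((P : ℤ) • z) i / (P : ℤ)) = g z
  congr 1
  funext i
  simp only [Pi.smul_apply, smul_eq_mul]
  exact Int.mul_ediv_cancel_left _ hP0

/-- The block-constant extension of an `N`-periodic coarse field is `(N·P)`-periodic (`P ≥ 1`). [folklore] -/
theorem blockConst_periodic {α : Type*} {g : Site d → α} {N P : ℕ} (hP : 1 ≤ P) (hg : ∀ (z : Site d) (i : Fin d), g (z + (N : ℤ) • e i) = g z) :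
    ∀ (x : Site d) (i : Fin d), (fun x : Site d => g (fun i => x i / (P : ℤ))) (x + ((N * P : ℕ) : ℤ) • e i)
      = (fun x : Site d => g (fun i => x i / (P : ℤ))) x := by
  intro x i
  have hP0 : (P : ℤ) ≠ 0 := by exact_mod_cast (by omega : P ≠ 0)
  have e1 : (fun k => (x + ((N * P : ℕ) : ℤ) • e i) k / (P : ℤ)) = (fun k => x k / (P : ℤ)) + (N : ℤ) • e i := by
    funext k
    simp only [Pi.add_apply, Pi.smul_apply, smul_eq_mul]
    push_cast
    rw [show x k + (N : ℤ) * (P : ℤ) * e i k = x k + ((N : ℤ) * e i k) * (P : ℤ) by ring, Int.add_mul_ediv_right _ _ hP0]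
  show g (fun k => (x + ((N * P : ℕ) : ℤ) • e i) k / (P : ℤ)) = g (fun k => x k / (P : ℤ))
  rw [e1, hg]

/-! ## §2 Bondwise estimates -/

/-- `‖W⁻¹Z − 1‖ = ‖Z − W‖` for a unitary `W`. [folklore] -/
theorem norm_relVal_eq [Nonempty n] {W : (Matrix n n ℂ)ˣ} (hW : W ∈ unitaryUnits (Matrix n n ℂ)) (Z : Matrix n n ℂ) :
    ‖((W⁻¹ : (Matrix n n ℂ)ˣ) : Matrix n n ℂ) * Z - 1‖ = ‖Z - (W : Matrix n n ℂ)‖ := by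
  letI : CStarAlgebra (Matrix n n ℂ) := {}
  have e : ((W⁻¹ : (Matrix n n ℂ)ˣ) : Matrix n n ℂ) * Z - 1 = ((W⁻¹ : (Matrix n n ℂ)ˣ) : Matrix n n ℂ) * (Z - (W : Matrix n n ℂ)) := by
    rw [mul_sub, Units.inv_mul]
  rw [e, CStarRing.norm_mem_unitary_mul _ (inv_mem_unitary hW)]

/-- Regauging a unitary bond variable by near-identity gauges: `‖uAv⁻¹ − A‖ ≤ ‖u − 1‖ + ‖v − 1‖`. [folklore] -/
theorem norm_regauge_sub_le [Nonempty n] {u v A : (Matrix n n ℂ)ˣ} (hv : v ∈ unitaryUnits (Matrix n n ℂ)) (hA : A ∈ unitaryUnits (Matrix n n ℂ)) :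
    ‖(u : Matrix n n ℂ) * (A : Matrix n n ℂ) * ((v⁻¹ : (Matrix n n ℂ)ˣ) : Matrix n n ℂ) - (A : Matrix n n ℂ)‖
      ≤ ‖(u : Matrix n n ℂ) - 1‖ + ‖(v : Matrix n n ℂ) - 1‖ := by
  letI : CStarAlgebra (Matrix n n ℂ) := {}
  have e : (u : Matrix n n ℂ) * (A : Matrix n n ℂ) * ((v⁻¹ : (Matrix n n ℂ)ˣ) : Matrix n n ℂ) - (A : Matrix n n ℂ)
      = ((u : Matrix n n ℂ) - 1) * ((A : Matrix n n ℂ) * ((v⁻¹ : (Matrix n n ℂ)ˣ) : Matrix n n ℂ))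
        + (A : Matrix n n ℂ) * (((v⁻¹ : (Matrix n n ℂ)ˣ) : Matrix n n ℂ) * (1 - (v : Matrix n n ℂ))) := by
    rw [mul_sub, mul_one, Units.inv_mul]; noncomm_ring
  rw [e]
  calc _ ≤ ‖((u : Matrix n n ℂ) - 1) * ((A : Matrix n n ℂ) * ((v⁻¹ : (Matrix n n ℂ)ˣ) : Matrix n n ℂ))‖
        + ‖(A : Matrix n n ℂ) * (((v⁻¹ : (Matrix n n ℂ)ˣ) : Matrix n n ℂ) * (1 - (v : Matrix n n ℂ)))‖ := norm_add_le _ _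
    _ = ‖(u : Matrix n n ℂ) - 1‖ + ‖(v : Matrix n n ℂ) - 1‖ := by
        rw [CStarRing.norm_mul_mem_unitary _ (Submonoid.mul_mem _ (mem_unitaryUnits.mp hA) (inv_mem_unitary hv)),
          CStarRing.norm_mem_unitary_mul _ (mem_unitaryUnits.mp hA), CStarRing.norm_mem_unitary_mul _ (inv_mem_unitary hv), norm_sub_rev (1 : Matrix n n ℂ) (v : Matrix n n ℂ)]

/-- A unitary gauge moves two configurations isometrically, bond by bond. [folklore] -/
theorem norm_gaugeAct_sub_gaugeAct [Nonempty n] {u : Site d → (Matrix n n ℂ)ˣ} (hu : IsUnitarySite u) (A B : Site d → Fin d → (Matrix n n ℂ)ˣ) (x : Site d) (κ : Fin d) :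
    ‖((gaugeAct u A x κ : (Matrix n n ℂ)ˣ) : Matrix n n ℂ) - ((gaugeAct u B x κ : (Matrix n n ℂ)ˣ) : Matrix n n ℂ)‖ = ‖(A x κ : Matrix n n ℂ) - (B x κ : Matrix n n ℂ)‖ := by
  letI : CStarAlgebra (Matrix n n ℂ) := {}
  have e : ((gaugeAct u A x κ : (Matrix n n ℂ)ˣ) : Matrix n n ℂ) - ((gaugeAct u B x κ : (Matrix n n ℂ)ˣ) : Matrix n n ℂ)
      = (u x : Matrix n n ℂ) * ((A x κ : Matrix n n ℂ) - (B x κ : Matrix n n ℂ)) * (((u (x + e κ))⁻¹ : (Matrix n n ℂ)ˣ) : Matrix n n ℂ) := by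
    simp only [gaugeAct, Units.val_mul, mul_sub, sub_mul]
  rw [e, CStarRing.norm_mul_mem_unitary _ (inv_mem_unitary (hu _)), CStarRing.norm_mem_unitary_mul _ (mem_unitaryUnits.mp (hu _))]

/-- Two chart configurations at the same unitary base differ bondwise by at most `3‖Φ − Φ′‖` (parameters of norm `≤ 1`). [folklore] -/
theorem norm_chart_sub_chart_le [Nonempty n] {M : ℕ} [NeZero M] {W : Site d → Fin d → (Matrix n n ℂ)ˣ} (hW : IsUnitaryCfg W) {Φ Φ' : TDir d n M}
    (hΦ : ‖Φ‖ ≤ 1) (hΦ' : ‖Φ'‖ ≤ 1) (x : Site d) (κ : Fin d) :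
    ‖((chart (ContinuousLinearMap.id ℝ (Matrix n n ℂ)) M W Φ x κ : (Matrix n n ℂ)ˣ) : Matrix n n ℂ)
        - ((chart (ContinuousLinearMap.id ℝ (Matrix n n ℂ)) M W Φ' x κ : (Matrix n n ℂ)ˣ) : Matrix n n ℂ)‖ ≤ 3 * ‖Φ - Φ'‖ := by
  letI : CStarAlgebra (Matrix n n ℂ) := {}
  have e : ((chart (ContinuousLinearMap.id ℝ (Matrix n n ℂ)) M W Φ x κ : (Matrix n n ℂ)ˣ) : Matrix n n ℂ)
        - ((chart (ContinuousLinearMap.id ℝ (Matrix n n ℂ)) M W Φ' x κ : (Matrix n n ℂ)ˣ) : Matrix n n ℂ)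
      = (W x κ : Matrix n n ℂ) * (exp (Φ (redN M x) κ) - exp (Φ' (redN M x) κ)) := by
    simp only [chart, chartDir, Units.val_mul, val_expUnit, ContinuousLinearMap.id_apply, mul_sub]
  rw [e, CStarRing.norm_mem_unitary_mul _ (mem_unitaryUnits.mp (hW x κ))]
  have h1 : ‖Φ (redN M x) κ‖ ≤ 1 := ((norm_le_pi_norm (Φ (redN M x)) κ).trans (norm_le_pi_norm Φ (redN M x))).trans hΦ
  have h2 : ‖Φ' (redN M x) κ‖ ≤ 1 := ((norm_le_pi_norm (Φ' (redN M x)) κ).trans (norm_le_pi_norm Φ' (redN M x))).trans hΦ'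
  have h3 : ‖Φ (redN M x) κ - Φ' (redN M x) κ‖ ≤ ‖Φ - Φ'‖ :=
    (norm_le_pi_norm ((Φ - Φ') (redN M x)) κ).trans (norm_le_pi_norm (Φ - Φ') (redN M x))
  have hexp : Real.exp (max ‖Φ (redN M x) κ‖ ‖Φ' (redN M x) κ‖) ≤ 3 := by
    have hm : max ‖Φ (redN M x) κ‖ ‖Φ' (redN M x) κ‖ ≤ 1 := max_le h1 h2
    have he : Real.exp 1 ≤ 3 := by have := Real.exp_one_lt_d9; linarith
    exact (Real.exp_le_exp.mpr hm).trans he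
  calc ‖exp (Φ (redN M x) κ) - exp (Φ' (redN M x) κ)‖
      ≤ ‖Φ (redN M x) κ - Φ' (redN M x) κ‖ * Real.exp (max ‖Φ (redN M x) κ‖ ‖Φ' (redN M x) κ‖) :=
        Literature.Analysis.Complex.norm_exp_sub_exp_le _ _
    _ ≤ ‖Φ - Φ'‖ * 3 := mul_le_mul h3 hexp (Real.exp_nonneg _) (norm_nonneg _)
    _ = 3 * ‖Φ - Φ'‖ := by ring

/-- `U♯·e^{X′}` is bondwise within `2‖X′(b)‖` of `U♯` (for `‖X′(b)‖ ≤ 1`). [folklore] -/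
theorem norm_vary_sub_le {W : Site d → Fin d → (Matrix n n ℂ)ˣ} {X : Site d → Fin d → Matrix n n ℂ} (x : Site d) (κ : Fin d)
    (hX : ‖X x κ‖ ≤ 1) :
    ‖(((W x κ)⁻¹ : (Matrix n n ℂ)ˣ) : Matrix n n ℂ) * ((vary W X 1 x κ : (Matrix n n ℂ)ˣ) : Matrix n n ℂ) - 1‖ ≤ 2 * ‖X x κ‖ := by
  have e : (((W x κ)⁻¹ : (Matrix n n ℂ)ˣ) : Matrix n n ℂ) * ((vary W X 1 x κ : (Matrix n n ℂ)ˣ) : Matrix n n ℂ) - 1 = exp (X x κ) - 1 := by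
    simp only [vary, Units.val_mul, val_expUnit, Complex.ofReal_one, one_smul, ← mul_assoc, Units.inv_mul, one_mul]
  rw [e]
  have h1 := B7Transfer.norm_exp_sub_one_le_of_le (X x κ) le_rfl
  have h2 : Real.exp ‖X x κ‖ - 1 ≤ 2 * ‖X x κ‖ := by
    have h := Real.abs_exp_sub_one_le (x := ‖X x κ‖) (by rw [abs_of_nonneg (norm_nonneg _)]; exact hX)
    rw [abs_of_nonneg (norm_nonneg _)] at h
    exact (le_abs_self _).trans h
  exact h1.trans h2

/-- A term of a finite sum of non-negative reals is at most the sum (the form used for the bond sums below). [folklore] -/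
theorem term_le_sum {ι : Type*} [Fintype ι] {f : ι → ℝ} (hf : ∀ i, 0 ≤ f i) (i : ι) : f i ≤ ∑ j, f j :=
  Finset.single_le_sum (f := f) (fun j _ => hf j) (Finset.mem_univ i)

/-! ## §3 The optimal stabiliser copy -/

/-- **THE OPTIMAL STABILISER COPY EXISTS.**  For a period `Mp : ℤ`, a corner scale `P : ℤ`, a datum `V₀`, configurations `U♯`, `U` and a box size `M`: over the unitary `Mp`-periodic
site fields `u` whose corner values `z ↦ u(P•z)` fix `V₀` bondwise, the sum over the box bonds `(r, κ)` of `‖U♯(b)⁻¹·(U^{u})(b) − 1‖` attains its minimum, provided the family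
is non-empty (compactness of the unitary periodic gauges, `NE7GaugeGroupCompact`). [folklore] -/
theorem exists_optimal_stab_copy {M : ℕ} (Mp P : ℤ) (V₀ Us U : Site d → Fin d → (Matrix n n ℂ)ˣ) {u₀ : Site d → (Matrix n n ℂ)ˣ}
    (hu₀ : IsUnitarySite u₀) (hu₀P : IsPeriodicSite u₀ Mp)
    (hu₀fix : ∀ (z : Site d) (κ : Fin d), (u₀ (P • z) : Matrix n n ℂ) * (V₀ z κ : Matrix n n ℂ) * (((u₀ (P • (z + e κ)))⁻¹ : (Matrix n n ℂ)ˣ) : Matrix n n ℂ) = V₀ z κ) :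
    ∃ us : Site d → (Matrix n n ℂ)ˣ, IsUnitarySite us ∧ IsPeriodicSite us Mp ∧
      (∀ (z : Site d) (κ : Fin d), (us (P • z) : Matrix n n ℂ) * (V₀ z κ : Matrix n n ℂ) * (((us (P • (z + e κ)))⁻¹ : (Matrix n n ℂ)ˣ) : Matrix n n ℂ) = V₀ z κ) ∧
      ∀ u : Site d → (Matrix n n ℂ)ˣ, IsUnitarySite u → IsPeriodicSite u Mp →
        (∀ (z : Site d) (κ : Fin d), (u (P • z) : Matrix n n ℂ) * (V₀ z κ : Matrix n n ℂ) * (((u (P • (z + e κ)))⁻¹ : (Matrix n n ℂ)ˣ) : Matrix n n ℂ) = V₀ z κ) →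
        ∑ rκ : (Fin d → Fin M) × Fin d, ‖(((Us (boxVec M rκ.1) rκ.2)⁻¹ : (Matrix n n ℂ)ˣ) : Matrix n n ℂ) * ((gaugeAct us U (boxVec M rκ.1) rκ.2 : (Matrix n n ℂ)ˣ) : Matrix n n ℂ) - 1‖
          ≤ ∑ rκ : (Fin d → Fin M) × Fin d, ‖(((Us (boxVec M rκ.1) rκ.2)⁻¹ : (Matrix n n ℂ)ˣ) : Matrix n n ℂ) * ((gaugeAct u U (boxVec M rκ.1) rκ.2 : (Matrix n n ℂ)ˣ) : Matrix n n ℂ) - 1‖ := by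
  -- the family: a closed subset of the compact unitary periodic gauges
  set 𝒢 : Set (Site d → (Matrix n n ℂ)ˣ) := {u | (IsUnitarySite u ∧ IsPeriodicSite u Mp) ∧
    ∀ (z : Site d) (κ : Fin d), (u (P • z) : Matrix n n ℂ) * (V₀ z κ : Matrix n n ℂ) * (((u (P • (z + e κ)))⁻¹ : (Matrix n n ℂ)ˣ) : Matrix n n ℂ) = V₀ z κ} with h𝒢
  have hval : ∀ x : Site d, Continuous fun u : Site d → (Matrix n n ℂ)ˣ => (u x : Matrix n n ℂ) := fun x => Units.continuous_val.comp (continuous_apply x)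
  have hinv : ∀ x : Site d, Continuous fun u : Site d → (Matrix n n ℂ)ˣ => (((u x)⁻¹ : (Matrix n n ℂ)ˣ) : Matrix n n ℂ) := fun x =>
    Units.continuous_coe_inv.comp (continuous_apply x)
  have hclosed : IsClosed {u : Site d → (Matrix n n ℂ)ˣ | ∀ (z : Site d) (κ : Fin d),
      (u (P • z) : Matrix n n ℂ) * (V₀ z κ : Matrix n n ℂ) * (((u (P • (z + e κ)))⁻¹ : (Matrix n n ℂ)ˣ) : Matrix n n ℂ) = V₀ z κ} := by
    simp only [Set.setOf_forall]
    exact isClosed_iInter fun z => isClosed_iInter fun κ => isClosed_eq (((hval _).mul continuous_const).mul (hinv _)) continuous_const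
  have h𝒢c : IsCompact 𝒢 := by
    rw [h𝒢, Set.setOf_and]
    exact (isCompact_unitaryPeriodicSite (d := d) (n := n) Mp).inter_right hclosed
  -- the functional is continuous
  set Ψ : (Site d → (Matrix n n ℂ)ˣ) → ℝ := fun u => ∑ rκ : (Fin d → Fin M) × Fin d,
    ‖(((Us (boxVec M rκ.1) rκ.2)⁻¹ : (Matrix n n ℂ)ˣ) : Matrix n n ℂ) * ((gaugeAct u U (boxVec M rκ.1) rκ.2 : (Matrix n n ℂ)ˣ) : Matrix n n ℂ) - 1‖ with hΨ
  have hΨc : Continuous Ψ := by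
    refine continuous_finsetSum _ fun rκ _ => ?_
    have h1 : Continuous fun u : Site d → (Matrix n n ℂ)ˣ => ((gaugeAct u U (boxVec M rκ.1) rκ.2 : (Matrix n n ℂ)ˣ) : Matrix n n ℂ) := by
      have e1 : (fun u : Site d → (Matrix n n ℂ)ˣ => ((gaugeAct u U (boxVec M rκ.1) rκ.2 : (Matrix n n ℂ)ˣ) : Matrix n n ℂ))
          = fun u => (u (boxVec M rκ.1) : Matrix n n ℂ) * (U (boxVec M rκ.1) rκ.2 : Matrix n n ℂ) * (((u (boxVec M rκ.1 + e rκ.2))⁻¹ : (Matrix n n ℂ)ˣ) : Matrix n n ℂ) := by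
        funext u; simp only [gaugeAct, Units.val_mul]
      rw [e1]
      exact ((hval _).mul continuous_const).mul (hinv _)
    exact ((continuous_const.mul h1).sub continuous_const).norm
  obtain ⟨us, hus, hmin⟩ := h𝒢c.exists_isMinOn ⟨u₀, ⟨hu₀, hu₀P⟩, hu₀fix⟩ hΨc.continuousOn
  exact ⟨us, hus.1.1, hus.1.2, hus.2, fun u hu huP hfix => hmin ⟨⟨hu, huP⟩, hfix⟩⟩

end

end Summit.QuantumFields.BalabanUV.T4Continuum.NE7MinimiserLipschitzPrep
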